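import Summits.BirchSwinnertonDyer.BirchSwinnertonDyer.Theorems.KolyvaginRoadThreeSchneiderTamAtThreeHeightLogNumeratorSplitSecondDigitLaw
import Summits.BirchSwinnertonDyer.BirchSwinnertonDyer.Theorems.KolyvaginRoadThreeSchneiderTamAtThreeHeightLogNumeratorSplitThree
import HarnessLib

/-!
# The split `3`-adic height — the SECOND-DIGIT ROW CHECKER at `3` (`‖R‖₃` beats the error ⟹ `RegMult.CertSplit W 3 Q 1`)
# and two rows of record whose tabulated point is a FORCED triple `Q = 3·Q'` (first digit dead by construction)

HONEST FRAMING (cell `bsd-stepL`, seat `bsd-stepL-tam3-p2` g4; `--supports stmt-BirchSwinnertonDyer-19154 --as helper`):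
THEOREMS ONLY; 0 definitions, 0 named facts, 0 sorry; ONE curve per application; nothing class-wide; BSD asserted
nowhere. Imports `…SplitThree` (for `mult_three_of_model`; cone of route `KolyvaginRoadThree` — lint known; the law is
route-free: `…SplitSecondDigit{,Law}`).

* `heightSplitCoord_ne_zero_of_secondDigitRow_three` — hypotheses: the integer model and point data as in the
  first-digit checkers (`e = 3^k e'`, `gcd(a, e) = 1`, `3 ∤ b`, `c₄`, `c₆`, `Δ = 3^νΔ'`, `U`, `N_L = U² − c₄¹² = 3^{v_L}n_L`,
  `1 ≤ v_L`, `v_L + 2 ≤ 2ν`, `3^{α'} ∣ a² − 1`), the RATIONAL main term `R = N_R/D_R` (an identity of rational numbers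
  decided by `norm_num`), `3^{n} ∥ N_R`, `3^{d} ∥ D_R`, and **`n − d < min(2k + 1, 4α', 2k + 2 − v_L)`** ⟹
  `heightSplitCoord W 3 q x y ≠ 0` for every Tate parameter `q` (`‖ĥ₃^{split}(Q)‖ = 3^{d−n}`).
* `certSplit_of_secondDigitRow_three` — + the gcd admissibility test ⟹ `RegMult.CertSplit W 3 Q 1`.
* Rows of record (evidence SPLIT3-ROWS-v2.tsv on 19154 marks them `silent:p|m0` for every first-digit criterion).

References: [SteinWuthrich2013] §4.2 (p. 16); [SilvermanAEC2009] VII.2.1; [Iwasawa1972PadicL] §4.4; [Cremona1997] Table 1.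
-/

noncomputable section

open scoped Classical
open Filter Topology IsUltrametricDist
open WeierstrassCurve Literature.NumberTheory.EllipticCurves
open Literature.NumberTheory.EllipticCurves.SteinWuthrich2013
open Literature.NumberTheory.EllipticCurves.TateCurve
open Literature.NumberTheory.EllipticCurves.Rank1Residual
open Summit.BirchSwinnertonDyer.Uniform.UI.O2
open Summit.BirchSwinnertonDyer.Rank1Residual Summit.BirchSwinnertonDyer.Rank1Residual.X11b
open Summit.BirchSwinnertonDyer.BirchSwinnertonDyer.Rank1Residual

namespace Summit.BirchSwinnertonDyer.Rank1Residual.X11b.RegMult.HeightLogNumerator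

/-! ### §16 The second-digit row checker at `3` -/

section SecondDigitChecker

/-- **The second-digit law in RATIONAL currency.** For `W = ⟨a₁,…,a₆⟩` globally minimal, multiplicative at `3`
(type `I_ν`), the point `(x, y) = (a/e², b/e³)` on `W` (`e = 3^k e'`, `k ≥ 1`, `3 ∤ e'`, `3 ∤ b`, `gcd(a, e) = 1`), the
integer data `c₄, c₆, Δ = 3^νΔ'`, `U`, `N_L = U² − c₄¹² = 3^{v_L}n_L` (`3 ∤ n_L`, `1 ≤ v_L`, `v_L + 2 ≤ 2ν`), `3^{α'} ∣ a² − 1`: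
for every Tate parameter `q`, **`‖ĥ₃^{split}(x, y) − R‖₃ ≤ max(3^{−(2k+1)}, 3^{−4α'}, 3^{v_L−2k−2})`** with the explicit
RATIONAL number `R` of the module docstring (read in `ℚ₃`). [cite: SteinWuthrich2013, §4.2] [cite: Iwasawa1972PadicL, §4.4] -/
theorem norm_heightSplitCoord_sub_ratMain_le_three (W : WeierstrassCurve ℚ) {a₁ a₂ a₃ a₄ a₆ : ℤ}
    (hW : W = ⟨a₁, a₂, a₃, a₄, a₆⟩) [W.IsElliptic] [W.IsGloballyMinimal] (hWm : Mult W 3)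
    {a b c4 c6 Dp U NL nL : ℤ} {e' k ν vL αp : ℕ}
    (H : ¬ 3 ∣ e' ∧ 1 ≤ k ∧ Nat.Coprime a.natAbs (3 ^ k * e') ∧ ¬ (3 : ℤ) ∣ b ∧
      c4 = (a₁ ^ 2 + 4 * a₂) ^ 2 - 24 * (2 * a₄ + a₁ * a₃) ∧
      c6 = -(a₁ ^ 2 + 4 * a₂) ^ 3 + 36 * (a₁ ^ 2 + 4 * a₂) * (2 * a₄ + a₁ * a₃) - 216 * (a₃ ^ 2 + 4 * a₆) ∧
      (3 : ℤ) ^ ν * Dp = -(a₁ ^ 2 + 4 * a₂) ^ 2 * (a₁ ^ 2 * a₆ + 4 * a₂ * a₆ - a₁ * a₃ * a₄ + a₂ * a₃ ^ 2 - a₄ ^ 2) -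
        8 * (2 * a₄ + a₁ * a₃) ^ 3 - 27 * (a₃ ^ 2 + 4 * a₆) ^ 2 +
        9 * (a₁ ^ 2 + 4 * a₂) * (2 * a₄ + a₁ * a₃) * (a₃ ^ 2 + 4 * a₆) ∧
      ¬ (3 : ℤ) ∣ c4 ∧ ¬ (3 : ℤ) ∣ Dp ∧
      U = Dp * c4 ^ 3 + 744 * (3 : ℤ) ^ ν * Dp ^ 2 ∧ NL = U ^ 2 - c4 ^ 12 ∧
      NL = (3 : ℤ) ^ vL * nL ∧ ¬ (3 : ℤ) ∣ nL ∧ 1 ≤ vL ∧ vL + 2 ≤ 2 * ν ∧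
      (3 : ℤ) ^ αp ∣ a ^ 2 - 1)
    {x y : ℚ} (hx : x = a / ((3 ^ k * e' : ℕ) : ℚ) ^ 2) (hy : y = b / ((3 ^ k * e' : ℕ) : ℚ) ^ 3)
    (hP : W.toAffine.Equation x y)
    {q : ℚ_[3]} (hq0 : q ≠ 0) (hq : ‖q‖ < 1) (hj : tateJ q = (W.j : ℚ_[3])) :
    ‖heightSplitCoord W 3 q x y - ((((1 / 2 : ℚ) * ((((a : ℚ)) ^ 2 - 1) - (((a : ℚ)) ^ 2 - 1) ^ 2 / 2 + (((a : ℚ)) ^ 2 - 1) ^ 3 / 3) +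
        ((a₁ : ℚ) ^ 2 + 4 * a₂) * (2 * (a₄ : ℚ) + a₁ * a₃) / (c4 : ℚ) * (((3 ^ k * e' : ℕ) : ℚ) ^ 2 / (a : ℚ)) -
        ((-(a : ℚ) * ((3 ^ k * e' : ℕ) : ℚ) / (b : ℚ)) +
            (a₁ : ℚ) / 2 * (-(a : ℚ) * ((3 ^ k * e' : ℕ) : ℚ) / (b : ℚ)) ^ 2 +
            ((a₁ : ℚ) ^ 2 + a₂) / 3 * (-(a : ℚ) * ((3 ^ k * e' : ℕ) : ℚ) / (b : ℚ)) ^ 3) ^ 2 *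
          (-((c6 : ℚ) / (c4 : ℚ))) /
          ((1 / 2 : ℚ) * (((NL : ℚ) / (c4 : ℚ) ^ 12) - ((NL : ℚ) / (c4 : ℚ) ^ 12) ^ 2 / 2 +
            ((NL : ℚ) / (c4 : ℚ) ^ 12) ^ 3 / 3))) : ℚ) : ℚ_[3])‖ ≤
      max ((3 : ℝ) ^ (-((2 * k + 1 : ℕ) : ℤ))) (max ((3 : ℝ) ^ (-((4 * αp : ℕ) : ℤ))) ((3 : ℝ) ^ ((vL : ℤ) - 2 * k - 2))) := by
  obtain ⟨hpe', hk, hcop, hpb, hc4, hc6, hD, hpc4, hpDp, hU, hNL, hnL, hpnL, hvL1, hvL, hαp⟩ := H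
  have hp1 : (1 : ℝ) < (3 : ℝ) := by norm_num
  have he'0 : e' ≠ 0 := by rintro rfl; exact hpe' (dvd_zero 3)
  have he0 : (3 ^ k * e' : ℕ) ≠ 0 := Nat.mul_ne_zero (pow_ne_zero _ (by norm_num)) he'0
  have hpe : 3 ∣ 3 ^ k * e' := dvd_mul_of_dvd_left (dvd_pow_self 3 (by omega)) _
  have h : W.toAffine.Nonsingular x y :=
    (WeierstrassCurve.Affine.equation_iff_nonsingular (W := W.toAffine)).mp hP
  have hx1 : 1 < ‖(x : ℚ_[3])‖ :=
    (one_lt_norm_ratCast_iff 3 x).mpr (KernelCert.padicValRat_x_neg he0 hx hcop hpe)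
  have hbn : ‖(b : ℚ_[3])‖ = 1 := BinaryQuartic.norm_intCast_eq_one (by exact_mod_cast hpb)
  have hc4n : ‖(c4 : ℚ_[3])‖ = 1 := BinaryQuartic.norm_intCast_eq_one (by exact_mod_cast hpc4)
  have hb0 : (b : ℚ_[3]) ≠ 0 := norm_pos_iff.mp (by rw [hbn]; exact one_pos)
  have hc40 : (c4 : ℚ_[3]) ≠ 0 := norm_pos_iff.mp (by rw [hc4n]; exact one_pos)
  have hpa : ¬ ((3 : ℕ) : ℤ) ∣ a := by
    intro hd
    have h1' : 3 ∣ a.natAbs := Int.natCast_dvd.mp hd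
    have h2' : 3 ∣ Nat.gcd a.natAbs (3 ^ k * e') := Nat.dvd_gcd h1' hpe
    rw [hcop] at h2'
    omega
  -- `num x = a`, `den x = e²`
  set E : ℕ := 3 ^ k * e' with hEdef
  have hE0 : (E : ℚ_[3]) ≠ 0 := by exact_mod_cast he0
  have hcop2 : Nat.Coprime a.natAbs (((E : ℤ) ^ 2).natAbs) := by
    rw [Int.natAbs_pow, Int.natAbs_natCast]; exact hcop.pow_right 2
  have hE2pos : (0 : ℤ) < (E : ℤ) ^ 2 := by positivity
  have hxq : x = ((a : ℤ) : ℚ) / (((E : ℤ) ^ 2 : ℤ) : ℚ) := by rw [hx]; push_cast; ring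
  have hnum : x.num = a := by rw [hxq]; exact Rat.num_div_eq_of_coprime hE2pos hcop2
  have hden : (x.den : ℤ) = (E : ℤ) ^ 2 := by rw [hxq]; exact Rat.den_div_eq_of_coprime hE2pos hcop2
  -- the model's invariants in `ℚ₃`
  set V := W.baseChange ℚ_[3] with hVdef
  have hVa1 : V.a₁ = (a₁ : ℚ_[3]) := by
    rw [hVdef, show (W.baseChange ℚ_[3]).a₁ = (W.a₁ : ℚ_[3]) from (map_a₁ W (algebraMap ℚ ℚ_[3])).trans (eq_ratCast _ _)]
    subst hW; push_cast; rfl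
  have hVa2 : V.a₂ = (a₂ : ℚ_[3]) := by
    rw [hVdef, show (W.baseChange ℚ_[3]).a₂ = (W.a₂ : ℚ_[3]) from (map_a₂ W (algebraMap ℚ ℚ_[3])).trans (eq_ratCast _ _)]
    subst hW; push_cast; rfl
  have hVb2 : V.b₂ = (a₁ : ℚ_[3]) ^ 2 + 4 * (a₂ : ℚ_[3]) := by
    rw [hVdef, show (W.baseChange ℚ_[3]).b₂ = (W.b₂ : ℚ_[3]) from (map_b₂ W (algebraMap ℚ ℚ_[3])).trans (eq_ratCast _ _)]
    subst hW; simp only [WeierstrassCurve.b₂]; push_cast; ring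
  have hVb4 : V.b₄ = 2 * (a₄ : ℚ_[3]) + (a₁ : ℚ_[3]) * (a₃ : ℚ_[3]) := by
    rw [hVdef, show (W.baseChange ℚ_[3]).b₄ = (W.b₄ : ℚ_[3]) from (map_b₄ W (algebraMap ℚ ℚ_[3])).trans (eq_ratCast _ _)]
    subst hW; simp only [WeierstrassCurve.b₄]; push_cast; ring
  have hWc4 : (W.c₄ : ℚ_[3]) = (c4 : ℚ_[3]) := by
    have : W.c₄ = (c4 : ℚ) := by
      subst hW; rw [hc4]; simp only [WeierstrassCurve.c₄, WeierstrassCurve.b₂, WeierstrassCurve.b₄]; push_cast; ring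
    rw [this]; push_cast; rfl
  have hVc4 : V.c₄ = (c4 : ℚ_[3]) := by
    rw [hVdef, show (W.baseChange ℚ_[3]).c₄ = (W.c₄ : ℚ_[3]) from (map_c₄ W (algebraMap ℚ ℚ_[3])).trans (eq_ratCast _ _)]
    exact hWc4
  have hWc6 : (W.c₆ : ℚ_[3]) = (c6 : ℚ_[3]) := by
    have : W.c₆ = (c6 : ℚ) := by
      subst hW; rw [hc6]
      simp only [WeierstrassCurve.c₆, WeierstrassCurve.b₂, WeierstrassCurve.b₄, WeierstrassCurve.b₆]; push_cast; ring
    rw [this]; push_cast; rfl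
  -- `log₃ q` to its third term, `V₀ = ½P₃(B₁)`
  obtain ⟨hV, hB₁n', hNLn⟩ := norm_padicLog_tateParam_sub_cubicMain_le_three W hW hc4 hD hpc4 hpDp hU hNL hnL hpnL
    hvL1 hvL hq0 hq hj
  set B₁ : ℚ_[3] := (NL : ℚ_[3]) / (c4 : ℚ_[3]) ^ 12 with hB₁
  set V₀ : ℚ_[3] := (2 : ℚ_[3])⁻¹ * (B₁ - B₁ ^ 2 / 2 + B₁ ^ 3 / 3) with hV₀
  have hB₁n : ‖B₁‖ = (3 : ℝ) ^ (-(vL : ℤ)) := by rw [hB₁, hB₁n', hNLn]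
  have hB₁le : ‖B₁‖ ≤ 1 / 3 := by
    rw [hB₁n, show (1 / 3 : ℝ) = (3 : ℝ) ^ (-(1 : ℤ)) by norm_num]
    exact zpow_le_zpow_right₀ (by norm_num) (by omega)
  have h2n : ‖(2 : ℚ_[3])⁻¹‖ = 1 := by
    rw [norm_inv, show (2 : ℚ_[3]) = ((2 : ℕ) : ℚ_[3]) by norm_num, Padic.norm_natCast_eq_one_iff.mpr (by decide),
      inv_one]
  have hV₀n : ‖V₀‖ = ‖B₁‖ := by
    have e : V₀ = (2 : ℚ_[3])⁻¹ * (B₁ * (1 + (-(B₁ / 2) + B₁ ^ 2 / 3))) := by rw [hV₀]; ring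
    have hsmall : ‖-(B₁ / 2) + B₁ ^ 2 / 3‖ < 1 := by
      refine (norm_add_le_max _ _).trans_lt (max_lt ?_ ?_)
      · rw [norm_neg, norm_div, show ‖(2 : ℚ_[3])‖ = 1 from by
          rw [show (2 : ℚ_[3]) = ((2 : ℕ) : ℚ_[3]) by norm_num]; exact Padic.norm_natCast_eq_one_iff.mpr (by decide),
          div_one]
        exact hB₁le.trans_lt (by norm_num)
      · rw [norm_div, norm_pow, show ‖(3 : ℚ_[3])‖ = 3⁻¹ from by
          rw [show (3 : ℚ_[3]) = ((3 : ℕ) : ℚ_[3]) by norm_cast, Padic.norm_p]; norm_num]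
        calc ‖B₁‖ ^ 2 / 3⁻¹ ≤ (1 / 3) ^ 2 / 3⁻¹ := by gcongr
          _ < 1 := by norm_num
    rw [e, norm_mul, h2n, one_mul, norm_mul, norm_one_add_eq_one_of_norm_lt_one hsmall, mul_one]
  have hV₀0 : V₀ ≠ 0 := norm_pos_iff.mp (by rw [hV₀n, hB₁n]; positivity)
  have hV' : ‖padicLog 3 q - V₀‖ ≤ 3⁻¹ ^ 2 * ‖V₀‖ := by rw [hV₀n, hB₁n']; exact hV
  -- the law at this point
  have hlaw := norm_heightSplitCoord_sub_secondMain_le_three hWm hq h hx1 hV₀0 hV'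
  rw [← hVdef] at hlaw
  set z : ℚ_[3] := -(x : ℚ_[3]) / y with hz
  set a3 : ℚ_[3] := ((x.num : ℚ) : ℚ_[3]) with ha3
  set M : ℚ_[3] := z + (2 : ℚ_[3])⁻¹ * V.a₁ * z ^ 2 + (3 : ℚ_[3])⁻¹ * (V.a₁ ^ 2 + V.a₂) * z ^ 3 with hM
  set R₃ : ℚ_[3] := (2 : ℚ_[3])⁻¹ * ((a3 ^ 2 - 1) - (a3 ^ 2 - 1) ^ 2 / 2 + (a3 ^ 2 - 1) ^ 3 / 3) +
      V.b₂ * V.b₄ / V.c₄ * (((x.den : ℚ) : ℚ_[3]) / a3) - M ^ 2 * (-((W.c₆ : ℚ_[3]) / (W.c₄ : ℚ_[3]))) / V₀ with hR₃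
  -- identify `R₃` with the rational main term
  have ha3a : a3 = (a : ℚ_[3]) := by rw [ha3, hnum, Rat.cast_intCast]
  have hdenQ : ((x.den : ℚ) : ℚ_[3]) = (E : ℚ_[3]) ^ 2 := by
    have : (x.den : ℚ) = (((E : ℤ) ^ 2 : ℤ) : ℚ) := by exact_mod_cast hden
    rw [this]; push_cast; ring
  have hzq : z = -(a : ℚ_[3]) * (E : ℚ_[3]) / (b : ℚ_[3]) := by
    rw [hz, hx, hy]; push_cast; field_simp
  have hR₃eq : R₃ = ((((1 / 2 : ℚ) * ((((a : ℚ)) ^ 2 - 1) - (((a : ℚ)) ^ 2 - 1) ^ 2 / 2 + (((a : ℚ)) ^ 2 - 1) ^ 3 / 3) +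
        ((a₁ : ℚ) ^ 2 + 4 * a₂) * (2 * (a₄ : ℚ) + a₁ * a₃) / (c4 : ℚ) * (((3 ^ k * e' : ℕ) : ℚ) ^ 2 / (a : ℚ)) -
        ((-(a : ℚ) * ((3 ^ k * e' : ℕ) : ℚ) / (b : ℚ)) +
            (a₁ : ℚ) / 2 * (-(a : ℚ) * ((3 ^ k * e' : ℕ) : ℚ) / (b : ℚ)) ^ 2 +
            ((a₁ : ℚ) ^ 2 + a₂) / 3 * (-(a : ℚ) * ((3 ^ k * e' : ℕ) : ℚ) / (b : ℚ)) ^ 3) ^ 2 *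
          (-((c6 : ℚ) / (c4 : ℚ))) /
          ((1 / 2 : ℚ) * (((NL : ℚ) / (c4 : ℚ) ^ 12) - ((NL : ℚ) / (c4 : ℚ) ^ 12) ^ 2 / 2 +
            ((NL : ℚ) / (c4 : ℚ) ^ 12) ^ 3 / 3))) : ℚ) : ℚ_[3]) := by
    rw [hR₃, ha3a, hdenQ, hVb2, hVb4, hVc4, hWc4, hWc6, hM, hVa1, hVa2, hzq, hV₀, hB₁]
    simp only [hEdef]
    push_cast
    simp only [one_div]
    ring
  rw [← hR₃eq]
  -- the three error terms
  have hxinv : ‖(x : ℚ_[3])‖⁻¹ = (3 : ℝ) ^ (-((2 * k : ℕ) : ℤ)) := by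
    have he'n : ‖(e' : ℚ_[3])‖ = 1 := by
      rw [show (e' : ℚ_[3]) = ((e' : ℤ) : ℚ_[3]) by norm_cast]
      exact BinaryQuartic.norm_intCast_eq_one (fun hd => hpe' (by exact_mod_cast hd))
    have hxp : (x : ℚ_[3]) = (a : ℚ_[3]) / (((3 : ℕ) : ℚ_[3]) ^ k * (e' : ℚ_[3])) ^ 2 := by
      rw [hx, hEdef]; push_cast; ring
    rw [hxp, norm_div, BinaryQuartic.norm_intCast_eq_one hpa, norm_pow, norm_mul, norm_pow, Padic.norm_p, he'n,
      mul_one, one_div, inv_inv, ← zpow_natCast, ← zpow_natCast, ← zpow_mul, inv_zpow']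
    push_cast; congr 1; ring
  have hz2 : ‖z‖ ^ 2 = ‖(x : ℚ_[3])‖⁻¹ := (norm_neg_div_of_one_lt_norm (p := 3) h hx1).2
  have hzle : ‖z‖ ≤ 3⁻¹ := by
    have hh := (norm_neg_div_of_one_lt_norm (p := 3) h hx1).1
    rw [← hz] at hh
    exact hh.trans (by norm_num)
  have herr1 : 3⁻¹ * ‖(x : ℚ_[3])‖⁻¹ ≤ (3 : ℝ) ^ (-((2 * k + 1 : ℕ) : ℤ)) := by
    rw [hxinv, show (3⁻¹ : ℝ) = (3 : ℝ) ^ (-(1 : ℤ)) by norm_num, ← zpow_add₀ (by norm_num : (3 : ℝ) ≠ 0)]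
    refine (zpow_le_zpow_iff_right₀ hp1).mpr ?_
    push_cast; omega
  have herr2 : ‖a3 ^ 2 - 1‖ ^ 4 ≤ (3 : ℝ) ^ (-((4 * αp : ℕ) : ℤ)) := by
    have hA : ‖a3 ^ 2 - 1‖ ≤ (3 : ℝ) ^ (-(αp : ℤ)) := by
      rw [ha3a, show (a : ℚ_[3]) ^ 2 - 1 = (((a ^ 2 - 1 : ℤ)) : ℚ_[3]) by push_cast; ring]
      have hαp' : ((3 : ℕ) : ℤ) ^ αp ∣ a ^ 2 - 1 := by exact_mod_cast hαp
      exact_mod_cast (Padic.norm_int_le_pow_iff_dvd (p := 3) (a ^ 2 - 1) αp).mpr hαp'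
    calc ‖a3 ^ 2 - 1‖ ^ 4 ≤ ((3 : ℝ) ^ (-(αp : ℤ))) ^ 4 := by gcongr
      _ = (3 : ℝ) ^ (-((4 * αp : ℕ) : ℤ)) := by rw [← zpow_natCast, ← zpow_mul]; congr 1; push_cast; ring
  have herr3 : 3⁻¹ ^ 2 * ‖M ^ 2 * (-((W.c₆ : ℚ_[3]) / (W.c₄ : ℚ_[3]))) / V₀‖ ≤ (3 : ℝ) ^ ((vL : ℤ) - 2 * k - 2) := by
    have ha1n : ‖V.a₁‖ ≤ 1 := by rw [hVa1]; exact Padic.norm_int_le_one _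
    have ha2n : ‖V.a₂‖ ≤ 1 := by rw [hVa2]; exact Padic.norm_int_le_one _
    have h3n : ‖(3 : ℚ_[3])⁻¹‖ = 3 := by
      rw [norm_inv, show (3 : ℚ_[3]) = ((3 : ℕ) : ℚ_[3]) by norm_cast, Padic.norm_p]; norm_num
    have hMle : ‖M‖ ≤ ‖z‖ := by
      rw [hM]
      refine (norm_add_le_max _ _).trans (max_le ((norm_add_le_max _ _).trans (max_le le_rfl ?_)) ?_)
      · rw [norm_mul, norm_mul, h2n, one_mul, norm_pow]
        calc ‖V.a₁‖ * ‖z‖ ^ 2 ≤ 1 * ‖z‖ ^ 2 := mul_le_mul_of_nonneg_right ha1n (sq_nonneg _)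
          _ = ‖z‖ * ‖z‖ := by ring
          _ ≤ 3⁻¹ * ‖z‖ := mul_le_mul_of_nonneg_right hzle (norm_nonneg _)
          _ ≤ 1 * ‖z‖ := mul_le_mul_of_nonneg_right (by norm_num) (norm_nonneg _)
          _ = ‖z‖ := one_mul _
      · rw [norm_mul, norm_mul, h3n, norm_pow]
        have hA : ‖V.a₁ ^ 2 + V.a₂‖ ≤ 1 := by
          refine (norm_add_le_max _ _).trans (max_le ?_ ha2n)
          rw [norm_pow]; exact pow_le_one₀ (norm_nonneg _) ha1n
        calc 3 * ‖V.a₁ ^ 2 + V.a₂‖ * ‖z‖ ^ 3 ≤ 3 * 1 * ‖z‖ ^ 3 := by gcongr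
          _ = (3 * ‖z‖ ^ 2) * ‖z‖ := by ring
          _ ≤ (3 * (3⁻¹) ^ 2) * ‖z‖ := by gcongr
          _ ≤ 1 * ‖z‖ := mul_le_mul_of_nonneg_right (by norm_num) (norm_nonneg _)
          _ = ‖z‖ := one_mul _
    have h46 : ‖-((W.c₆ : ℚ_[3]) / (W.c₄ : ℚ_[3]))‖ = 1 := by
      rw [norm_neg, norm_div, norm_c₆_eq_one_of_mult hWm, norm_c₄_eq_one_of_hasMultiplicativeReductionAtPrime hWm,
        div_one]
    rw [norm_div, norm_mul, h46, mul_one, hV₀n, hB₁n, norm_pow]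
    have hM2 : ‖M‖ ^ 2 ≤ (3 : ℝ) ^ (-((2 * k : ℕ) : ℤ)) := by
      rw [← hxinv, ← hz2]; gcongr
    calc (3⁻¹ : ℝ) ^ 2 * (‖M‖ ^ 2 / (3 : ℝ) ^ (-(vL : ℤ))) ≤ 3⁻¹ ^ 2 * ((3 : ℝ) ^ (-((2 * k : ℕ) : ℤ)) / (3 : ℝ) ^ (-(vL : ℤ))) := by
          gcongr
      _ = (3 : ℝ) ^ (-(2 : ℤ) + (-((2 * k : ℕ) : ℤ) - -(vL : ℤ))) := by
          rw [zpow_add₀ (by norm_num : (3 : ℝ) ≠ 0), zpow_sub₀ (by norm_num : (3 : ℝ) ≠ 0)]; norm_num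
      _ = (3 : ℝ) ^ ((vL : ℤ) - 2 * k - 2) := by congr 1; push_cast; ring
  exact hlaw.trans (max_le_max herr1 (max_le_max herr2 herr3))

/-- **SECOND-DIGIT SPLIT ROW CHECKER at `p = 3` (value form).** The rational law above + the certificate
`R = N_R/D_R`, `3^{n} ∥ N_R`, `3^{d} ∥ D_R`, `n − d < min(2k+1, 4α', 2k+2−v_L)` ⟹ `heightSplitCoord W 3 q x y ≠ 0` for
every Tate parameter `q` (`‖ĥ₃^{split}‖ = 3^{d−n}`). [cite: SteinWuthrich2013, §4.2] [cite: Iwasawa1972PadicL, §4.4] -/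
theorem heightSplitCoord_ne_zero_of_secondDigitRow_three (W : WeierstrassCurve ℚ) {a₁ a₂ a₃ a₄ a₆ : ℤ}
    (hW : W = ⟨a₁, a₂, a₃, a₄, a₆⟩) [W.IsElliptic] [W.IsGloballyMinimal] (hWm : Mult W 3)
    {a b c4 c6 Dp U NL nL NR DR : ℤ} {e' k ν vL αp n₁ d₁ : ℕ}
    (H : ¬ 3 ∣ e' ∧ 1 ≤ k ∧ Nat.Coprime a.natAbs (3 ^ k * e') ∧ ¬ (3 : ℤ) ∣ b ∧
      c4 = (a₁ ^ 2 + 4 * a₂) ^ 2 - 24 * (2 * a₄ + a₁ * a₃) ∧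
      c6 = -(a₁ ^ 2 + 4 * a₂) ^ 3 + 36 * (a₁ ^ 2 + 4 * a₂) * (2 * a₄ + a₁ * a₃) - 216 * (a₃ ^ 2 + 4 * a₆) ∧
      (3 : ℤ) ^ ν * Dp = -(a₁ ^ 2 + 4 * a₂) ^ 2 * (a₁ ^ 2 * a₆ + 4 * a₂ * a₆ - a₁ * a₃ * a₄ + a₂ * a₃ ^ 2 - a₄ ^ 2) -
        8 * (2 * a₄ + a₁ * a₃) ^ 3 - 27 * (a₃ ^ 2 + 4 * a₆) ^ 2 +
        9 * (a₁ ^ 2 + 4 * a₂) * (2 * a₄ + a₁ * a₃) * (a₃ ^ 2 + 4 * a₆) ∧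
      ¬ (3 : ℤ) ∣ c4 ∧ ¬ (3 : ℤ) ∣ Dp ∧
      U = Dp * c4 ^ 3 + 744 * (3 : ℤ) ^ ν * Dp ^ 2 ∧ NL = U ^ 2 - c4 ^ 12 ∧
      NL = (3 : ℤ) ^ vL * nL ∧ ¬ (3 : ℤ) ∣ nL ∧ 1 ≤ vL ∧ vL + 2 ≤ 2 * ν ∧
      (3 : ℤ) ^ αp ∣ a ^ 2 - 1)
    (Hc : (3 : ℤ) ^ n₁ ∣ NR ∧ ¬ (3 : ℤ) ^ (n₁ + 1) ∣ NR ∧ (3 : ℤ) ^ d₁ ∣ DR ∧ ¬ (3 : ℤ) ^ (d₁ + 1) ∣ DR ∧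
      (n₁ : ℤ) - d₁ < 2 * k + 1 ∧ (n₁ : ℤ) - d₁ < 4 * αp ∧ (n₁ : ℤ) - d₁ + vL < 2 * k + 2)
    (hR : ((1 / 2 : ℚ) * ((((a : ℚ)) ^ 2 - 1) - (((a : ℚ)) ^ 2 - 1) ^ 2 / 2 + (((a : ℚ)) ^ 2 - 1) ^ 3 / 3) +
        ((a₁ : ℚ) ^ 2 + 4 * a₂) * (2 * (a₄ : ℚ) + a₁ * a₃) / (c4 : ℚ) * (((3 ^ k * e' : ℕ) : ℚ) ^ 2 / (a : ℚ)) -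
        ((-(a : ℚ) * ((3 ^ k * e' : ℕ) : ℚ) / (b : ℚ)) +
            (a₁ : ℚ) / 2 * (-(a : ℚ) * ((3 ^ k * e' : ℕ) : ℚ) / (b : ℚ)) ^ 2 +
            ((a₁ : ℚ) ^ 2 + a₂) / 3 * (-(a : ℚ) * ((3 ^ k * e' : ℕ) : ℚ) / (b : ℚ)) ^ 3) ^ 2 *
          (-((c6 : ℚ) / (c4 : ℚ))) /
          ((1 / 2 : ℚ) * (((NL : ℚ) / (c4 : ℚ) ^ 12) - ((NL : ℚ) / (c4 : ℚ) ^ 12) ^ 2 / 2 +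
            ((NL : ℚ) / (c4 : ℚ) ^ 12) ^ 3 / 3))) = (NR : ℚ) / (DR : ℚ))
    {x y : ℚ} (hx : x = a / ((3 ^ k * e' : ℕ) : ℚ) ^ 2) (hy : y = b / ((3 ^ k * e' : ℕ) : ℚ) ^ 3)
    (hP : W.toAffine.Equation x y)
    {q : ℚ_[3]} (hq0 : q ≠ 0) (hq : ‖q‖ < 1) (hj : tateJ q = (W.j : ℚ_[3])) :
    heightSplitCoord W 3 q x y ≠ 0 := by
  obtain ⟨hn1, hn2, hd1, hd2, hlt1, hlt2, hlt3⟩ := Hc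
  have hp1 : (1 : ℝ) < (3 : ℝ) := by norm_num
  have hlaw := norm_heightSplitCoord_sub_ratMain_le_three W hW hWm H hx hy hP hq0 hq hj
  rw [hR] at hlaw
  have hNRn : ‖(NR : ℚ_[3])‖ = (3 : ℝ) ^ (-(n₁ : ℤ)) := by
    exact_mod_cast GaloisImage.PadicSquareClass.norm_intCast_padic_eq (p := 3) (by exact_mod_cast hn1)
      (by exact_mod_cast hn2)
  have hDRn : ‖(DR : ℚ_[3])‖ = (3 : ℝ) ^ (-(d₁ : ℤ)) := by
    exact_mod_cast GaloisImage.PadicSquareClass.norm_intCast_padic_eq (p := 3) (by exact_mod_cast hd1)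
      (by exact_mod_cast hd2)
  have hRn : ‖(((NR : ℚ) / (DR : ℚ) : ℚ) : ℚ_[3])‖ = (3 : ℝ) ^ ((d₁ : ℤ) - n₁) := by
    push_cast
    rw [norm_div, hNRn, hDRn, ← zpow_sub₀ (by norm_num : (3 : ℝ) ≠ 0)]
    congr 1; ring
  have herr : ‖heightSplitCoord W 3 q x y - (((NR : ℚ) / (DR : ℚ) : ℚ) : ℚ_[3])‖ ≤ (3 : ℝ) ^ ((d₁ : ℤ) - n₁ - 1) := by
    refine hlaw.trans (max_le ?_ (max_le ?_ ?_)) <;> refine zpow_le_zpow_right₀ hp1.le ?_ <;> push_cast <;> omega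
  intro h0
  rw [h0, zero_sub, norm_neg, hRn] at herr
  have : (3 : ℝ) ^ ((d₁ : ℤ) - n₁ - 1) < (3 : ℝ) ^ ((d₁ : ℤ) - n₁) := zpow_lt_zpow_right₀ hp1 (by omega)
  exact absurd herr (not_le.mpr this)

/-- **`RegMult.CertSplit W 3 Q 1` from the second-digit row checker** (+ the gcd admissibility test). ONE curve per
application; nothing class-wide. [cite: SteinWuthrich2013, §4.2] [cite: SilvermanAEC2009, VII.2.1] [cite: MazurSteinTate2006, §1] -/
theorem certSplit_of_secondDigitRow_three (W : WeierstrassCurve ℚ) {a₁ a₂ a₃ a₄ a₆ : ℤ}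
    (hW : W = ⟨a₁, a₂, a₃, a₄, a₆⟩) [W.IsElliptic] [W.IsGloballyMinimal] (hWm : Mult W 3)
    {a b c4 c6 Dp U NL nL NR DR : ℤ} {e' k n ν vL αp n₁ d₁ : ℕ}
    (Hg : Int.gcd (2 * b + a₁ * a * (3 ^ k * e' : ℕ) + a₃ * (3 ^ k * e' : ℕ) ^ 3)
        (a₁ * b * (3 ^ k * e' : ℕ) - (3 * a ^ 2 + 2 * a₂ * a * (3 ^ k * e' : ℕ) ^ 2 + a₄ * (3 ^ k * e' : ℕ) ^ 4))
        ∣ (3 ^ k * e') ^ n)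
    (H : ¬ 3 ∣ e' ∧ 1 ≤ k ∧ Nat.Coprime a.natAbs (3 ^ k * e') ∧ ¬ (3 : ℤ) ∣ b ∧
      c4 = (a₁ ^ 2 + 4 * a₂) ^ 2 - 24 * (2 * a₄ + a₁ * a₃) ∧
      c6 = -(a₁ ^ 2 + 4 * a₂) ^ 3 + 36 * (a₁ ^ 2 + 4 * a₂) * (2 * a₄ + a₁ * a₃) - 216 * (a₃ ^ 2 + 4 * a₆) ∧
      (3 : ℤ) ^ ν * Dp = -(a₁ ^ 2 + 4 * a₂) ^ 2 * (a₁ ^ 2 * a₆ + 4 * a₂ * a₆ - a₁ * a₃ * a₄ + a₂ * a₃ ^ 2 - a₄ ^ 2) -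
        8 * (2 * a₄ + a₁ * a₃) ^ 3 - 27 * (a₃ ^ 2 + 4 * a₆) ^ 2 +
        9 * (a₁ ^ 2 + 4 * a₂) * (2 * a₄ + a₁ * a₃) * (a₃ ^ 2 + 4 * a₆) ∧
      ¬ (3 : ℤ) ∣ c4 ∧ ¬ (3 : ℤ) ∣ Dp ∧
      U = Dp * c4 ^ 3 + 744 * (3 : ℤ) ^ ν * Dp ^ 2 ∧ NL = U ^ 2 - c4 ^ 12 ∧
      NL = (3 : ℤ) ^ vL * nL ∧ ¬ (3 : ℤ) ∣ nL ∧ 1 ≤ vL ∧ vL + 2 ≤ 2 * ν ∧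
      (3 : ℤ) ^ αp ∣ a ^ 2 - 1)
    (Hc : (3 : ℤ) ^ n₁ ∣ NR ∧ ¬ (3 : ℤ) ^ (n₁ + 1) ∣ NR ∧ (3 : ℤ) ^ d₁ ∣ DR ∧ ¬ (3 : ℤ) ^ (d₁ + 1) ∣ DR ∧
      (n₁ : ℤ) - d₁ < 2 * k + 1 ∧ (n₁ : ℤ) - d₁ < 4 * αp ∧ (n₁ : ℤ) - d₁ + vL < 2 * k + 2)
    (hR : ((1 / 2 : ℚ) * ((((a : ℚ)) ^ 2 - 1) - (((a : ℚ)) ^ 2 - 1) ^ 2 / 2 + (((a : ℚ)) ^ 2 - 1) ^ 3 / 3) +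
        ((a₁ : ℚ) ^ 2 + 4 * a₂) * (2 * (a₄ : ℚ) + a₁ * a₃) / (c4 : ℚ) * (((3 ^ k * e' : ℕ) : ℚ) ^ 2 / (a : ℚ)) -
        ((-(a : ℚ) * ((3 ^ k * e' : ℕ) : ℚ) / (b : ℚ)) +
            (a₁ : ℚ) / 2 * (-(a : ℚ) * ((3 ^ k * e' : ℕ) : ℚ) / (b : ℚ)) ^ 2 +
            ((a₁ : ℚ) ^ 2 + a₂) / 3 * (-(a : ℚ) * ((3 ^ k * e' : ℕ) : ℚ) / (b : ℚ)) ^ 3) ^ 2 *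
          (-((c6 : ℚ) / (c4 : ℚ))) /
          ((1 / 2 : ℚ) * (((NL : ℚ) / (c4 : ℚ) ^ 12) - ((NL : ℚ) / (c4 : ℚ) ^ 12) ^ 2 / 2 +
            ((NL : ℚ) / (c4 : ℚ) ^ 12) ^ 3 / 3))) = (NR : ℚ) / (DR : ℚ))
    {x y : ℚ} (hx : x = a / ((3 ^ k * e' : ℕ) : ℚ) ^ 2) (hy : y = b / ((3 ^ k * e' : ℕ) : ℚ) ^ 3)
    (h : W.toAffine.Nonsingular x y) :
    RegMult.CertSplit W 3 (.some x y h) 1 := by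
  have he'0 : e' ≠ 0 := by rintro rfl; exact H.1 (dvd_zero 3)
  have he0 : (3 ^ k * e' : ℕ) ≠ 0 := Nat.mul_ne_zero (pow_ne_zero _ (by norm_num)) he'0
  have hpe : 3 ∣ 3 ^ k * e' := dvd_mul_of_dvd_left (dvd_pow_self 3 (by have := H.2.1; omega)) _
  have hx1 : 1 < ‖(x : ℚ_[3])‖ :=
    (one_lt_norm_ratCast_iff 3 x).mpr (KernelCert.padicValRat_x_neg he0 hx H.2.2.1 hpe)
  have hadm : W.IsAdmissible 3 (.some x y h) :=
    isAdmissible_of_one_lt_norm (by norm_num) h hx1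
      (KernelCert.hasNonsingularReductionAt_of_gcd W hW he0 hx hy H.2.2.1 Hg)
  refine ⟨by rw [one_nsmul]; exact hadm, fun Dq => ?_⟩
  rw [one_nsmul]
  show heightSplitCoord W 3 Dq.q x y ≠ 0
  exact heightSplitCoord_ne_zero_of_secondDigitRow_three W hW hWm H Hc hR hx hy h.left Dq.q_ne_zero
    Dq.norm_q_lt_one Dq.tateJ_eq

end SecondDigitChecker

/-! ### §17 Two rows whose tabulated point is a forced `3·Q'` -/

section Rows

/-- **Cremona `477714d1` at the split prime `3` — a SECOND-DIGIT row** (`[1,0,0,8,200]`, `N = 477714`, type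
`I_3` at `3`): lane A's admissible point is `Q = 3·P` (`P = (2, 14)`; `3 ∣ m₀` is FORCED by the local
orders), so the first `3`-adic digit of `ĥ₃^{split}(Q) = 9·ĥ₃^{split}(Q/3)` is dead by construction (every first-digit
criterion is silent: `k = 1`, `v_L = 1`, `v₃(a² − 1) = 1 = 2k − v_L`, digit `0`); the SECOND-DIGIT certificate
`R = N_R/D_R` with `3^2 ∥ N_R`, `3^0 ∥ D_R`, `n − d = 2 < min(3, 4, 3)` decides:
**`RegMult.CertSplit W 3 Q 1`** (`‖ĥ₃^{split}(Q)‖₃ = 3^{−2}`; lane A's 48-digit value has `v₃ = 2`). ONE curve; nothing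
class-wide. [cite: SteinWuthrich2013, §4.2] [cite: Cremona1997, Table 1 (curve 477714d1)] -/
theorem certSplit_477714d1 (W : WeierstrassCurve ℚ) (hW : W = ⟨1, 0, 0, 8, 200⟩) [W.IsElliptic]
    [W.IsGloballyMinimal] :
    ∃ h : W.toAffine.Nonsingular ((12577 : ℚ) / 576) ((-1594469 : ℚ) / 13824), RegMult.CertSplit W 3 (.some _ _ h) 1 := by
  have hP : W.toAffine.Equation ((12577 : ℚ) / 576) ((-1594469 : ℚ) / 13824) := by
    subst hW; rw [WeierstrassCurve.Affine.equation_iff]; norm_num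
  refine ⟨(WeierstrassCurve.Affine.equation_iff_nonsingular (W := W.toAffine)).mp hP, ?_⟩
  exact certSplit_of_secondDigitRow_three W hW (mult_three_of_model W hW (c4 := -383) (D := -17197704) (by norm_num))
    (a := 12577) (b := -1594469) (c4 := -383) (c6 := -172225) (Dp := -636952) (U := 8185644462195176)
    (NL := 57041886355434036314525775639615) (nL := 19013962118478012104841925213205)
    (NR := 32480393186617558005584183137436896285786012665574123445032140097011359430063783684158240174258910471139413469951943657773609780157068724948145418735709647255968)
    (DR := 49239107811481808990396151469821039797122330451416638627547824533277284745775838126997242185743094603254627247317370414902842115462184877)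
    (e' := 8) (k := 1) (n := 0) (ν := 3) (vL := 1) (αp := 1) (n₁ := 2) (d₁ := 0)
    (by norm_num) (by norm_num) (by norm_num) (by norm_num) (by norm_num) (by norm_num) _

/-- **Cremona `418980e1` at the split prime `3` — a SECOND-DIGIT row** (`[0,1,0,-6,2169]`, `N = 418980`, type
`I_6` at `3`): lane A's admissible point is `Q = 6·P` (`P = (-6, 45)`; `3 ∣ m₀` is FORCED by the local
orders), so the first `3`-adic digit of `ĥ₃^{split}(Q) = 9·ĥ₃^{split}(Q/3)` is dead by construction (every first-digit
criterion is silent: `k = 1`, `v_L = 1`, `v₃(a² − 1) = 1 = 2k − v_L`, digit `0`); the SECOND-DIGIT certificate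
`R = N_R/D_R` with `3^2 ∥ N_R`, `3^0 ∥ D_R`, `n − d = 2 < min(3, 4, 3)` decides:
**`RegMult.CertSplit W 3 Q 1`** (`‖ĥ₃^{split}(Q)‖₃ = 3^{−2}`; lane A's 48-digit value has `v₃ = 2`). ONE curve; nothing
class-wide. [cite: SteinWuthrich2013, §4.2] [cite: Cremona1997, Table 1 (curve 418980e1)] -/
theorem certSplit_418980e1 (W : WeierstrassCurve ℚ) (hW : W = ⟨0, 1, 0, -6, 2169⟩) [W.IsElliptic]
    [W.IsGloballyMinimal] :
    ∃ h : W.toAffine.Nonsingular ((8221 : ℚ) / 4356) ((13386205 : ℚ) / 287496), RegMult.CertSplit W 3 (.some _ _ h) 1 := by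
  have hP : W.toAffine.Equation ((8221 : ℚ) / 4356) ((13386205 : ℚ) / 287496) := by
    subst hW; rw [WeierstrassCurve.Affine.equation_iff]; norm_num
  refine ⟨(WeierstrassCurve.Affine.equation_iff_nonsingular (W := W.toAffine)).mp hP, ?_⟩
  exact certSplit_of_secondDigitRow_three W hW (mult_three_of_model W hW (c4 := 304) (D := -2036242800) (by norm_num))
    (a := 8221) (b := 13386205) (c4 := 304) (c6 := -1875808) (Dp := -2793200) (U := 4231520767929395200)
    (NL := 17905767386425013171468875226765328384) (nL := 5968589128808337723822958408921776128)
    (NR := 36339887004776804500581385804316186418752547171195709691841692407774175689631384369606020940341783794485576336314588762926831808086036593086461220965699381740928)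
    (DR := 706296351202814445850774591621325800033506520079939514881516226180276796877334483897029788251634735592004213609812350394133089367542078125)
    (e' := 22) (k := 1) (n := 0) (ν := 6) (vL := 1) (αp := 1) (n₁ := 2) (d₁ := 0)
    (by norm_num) (by norm_num) (by norm_num) (by norm_num) (by norm_num) (by norm_num) _

end Rows

end Summit.BirchSwinnertonDyer.Rank1Residual.X11b.RegMult.HeightLogNumerator

end
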